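import Summits.KontsevichZagierPeriods.KontsevichZagierPeriods.Theses.IsogenyCertificates
import Mathlib.RingTheory.Algebraic.Integral

/-!
# `AlgebraicModuliRealPeriodCell` (stmt-KontsevichZagierPeriods-18265, route IsogenyCertificates) —
line `Sketch`, stub T: the duplication datum for REAL moduli

Port of the `ℚ`-line's `Theorems/IsogenyCertificatesXMapPeriodTransferStubDupDatum.lean` (moduli
`A B : ℤ`, polynomials in `ℚ[X]`) to real moduli `α β : ℝ` and `ℝ[X]` (pure algebra; the only new
item is `dupDatum_coeff_isAlgebraic`: for real ALGEBRAIC `α, β` the datum has algebraic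
coefficients and the multiplier `2` is algebraic, which is what the line's inline datum requires).

For `y² = P(x) = x³ + αx + β` the x-map of multiplication by `2` is `f₂/g₂` with
`f₂ = X⁴ − 2αX² − 8βX + α²` and `g₂ = 4P`. We prove that `(f₂, g₂, 2)` is an x-rational isogeny
datum of the crux's shape:

* the Wronskian `W₂ = f₂'g₂ − f₂g₂' = 4X⁶ + 20αX⁴ + 80βX³ − 20α²X² − 16αβX − (4α³ + 32β²)` is
  non-zero (its `X⁶`-coefficient is `4`);
* the certificate identity `2²·g₂·(f₂³ + α f₂ g₂² + β g₂³) = P·W₂²` (a `ring` identity);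
* `IsCoprime f₂ g₂` when `Δ = 4α³ + 27β² ≠ 0`, by the explicit Bezout identity
  `a²·f₂ + (8Xa² + 2abP' + b²P)·P = (aP' + bP)² = Δ²` with `P' = 3X² + α`,
  `a = −6αX² + 9βX − 4α²`, `b = 18αX − 27β` (using `f₂ = P'² − 8XP` and `aP' + bP = −Δ`);
* the 2-descent inequality `e ≤ f₂(x)/g₂(x)` for every real root `e` of `P` and every real `x`
  with `P(x) > 0`, from the square identity
  `f₂ − e·g₂ = (x² − 2ex − 2e² − α)² − 4(2x + e)(e³ + αe + β)`.

References: J. H. Silverman, *The Arithmetic of Elliptic Curves* (2009), III.2.3(d) (duplication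
formula); J. W. S. Cassels, *Lectures on Elliptic Curves* (1991), §15 (2-descent); the computations
are adapted from the `ℚ`-line's file (originally `Cruxes/XMapPeriodTransfer/SketchIdeator3.lean`).
-/

open Set Polynomial

namespace Summit.KontsevichZagierPeriods.IsogenyCertificates.AlgRealPeriodCell.TransferDupDatum

-- adapted from Theorems/IsogenyCertificatesXMapPeriodTransferStubDupDatum.lean (`ℚ ↦ ℝ`)
/-- Wronskian of the duplication datum:
`W₂ = 4X⁶ + 20αX⁴ + 80βX³ − 20α²X² − 16αβX − (4α³ + 32β²)` (= `ψ₄/y`). [folklore] -/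
private theorem stub_dupDatum_wronskian (A B : ℝ) :
    derivative (X ^ 4 - C (2 * A) * X ^ 2 - C (8 * B) * X + C (A ^ 2)) *
        (C 4 * (X ^ 3 + C A * X + C B)) -
      (X ^ 4 - C (2 * A) * X ^ 2 - C (8 * B) * X + C (A ^ 2)) *
        derivative (C 4 * (X ^ 3 + C A * X + C B)) =
    C 4 * X ^ 6 + C (20 * A) * X ^ 4 + C (80 * B) * X ^ 3 - C (20 * A ^ 2) * X ^ 2 -
      C (16 * A * B) * X - C (4 * A ^ 3 + 32 * B ^ 2) := by
  simp only [derivative_sub, derivative_add, derivative_mul, derivative_X_pow, derivative_C,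
    derivative_X, Nat.cast_ofNat, Nat.add_one_sub_one, pow_one, zero_mul, zero_add,
    add_zero, mul_one]
  refine Polynomial.funext fun x => ?_
  simp only [eval_sub, eval_add, eval_mul, eval_pow, eval_C, eval_X]
  ring

-- adapted from Theorems/IsogenyCertificatesXMapPeriodTransferStubDupDatum.lean (`ℚ ↦ ℝ`)
/-- The Wronskian `W₂` of the duplication datum is non-zero (its `X⁶`-coefficient is `4`).
[folklore] -/
private theorem stub_dupDatum_wronskian_ne_zero (A B : ℝ) :
    derivative (X ^ 4 - C (2 * A) * X ^ 2 - C (8 * B) * X + C (A ^ 2)) *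
        (C 4 * (X ^ 3 + C A * X + C B)) -
      (X ^ 4 - C (2 * A) * X ^ 2 - C (8 * B) * X + C (A ^ 2)) *
        derivative (C 4 * (X ^ 3 + C A * X + C B)) ≠ 0 := by
  rw [stub_dupDatum_wronskian]
  intro h
  have := congrArg (fun p : ℝ[X] => p.coeff 6) h
  simp only [coeff_add, coeff_sub, coeff_C_mul, coeff_X_pow, coeff_C, coeff_X, coeff_zero] at this
  norm_num at this

-- adapted from Theorems/IsogenyCertificatesXMapPeriodTransferStubDupDatum.lean (`ℚ ↦ ℝ`)
/-- The certificate identity of the duplication datum with multiplier `c = 2`: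
`2²·g₂·(f₂³ + α f₂ g₂² + β g₂³) = P·W₂²` (degree `13`, checked by `ring` after evaluation).
[folklore] -/
private theorem stub_dupDatum_isDatum (A B : ℝ) :
    C ((2 : ℝ) ^ 2) * (C 4 * (X ^ 3 + C A * X + C B)) *
      ((X ^ 4 - C (2 * A) * X ^ 2 - C (8 * B) * X + C (A ^ 2)) ^ 3 +
        C A * (X ^ 4 - C (2 * A) * X ^ 2 - C (8 * B) * X + C (A ^ 2)) *
          (C 4 * (X ^ 3 + C A * X + C B)) ^ 2 +
        C B * (C 4 * (X ^ 3 + C A * X + C B)) ^ 3) =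
    (X ^ 3 + C A * X + C B) *
      (derivative (X ^ 4 - C (2 * A) * X ^ 2 - C (8 * B) * X + C (A ^ 2)) *
          (C 4 * (X ^ 3 + C A * X + C B)) -
        (X ^ 4 - C (2 * A) * X ^ 2 - C (8 * B) * X + C (A ^ 2)) *
          derivative (C 4 * (X ^ 3 + C A * X + C B))) ^ 2 := by
  rw [stub_dupDatum_wronskian]
  refine Polynomial.funext fun x => ?_
  simp only [eval_sub, eval_add, eval_mul, eval_pow, eval_C, eval_X]
  ring

/-- Abstract Bezout identity behind the coprimality of the duplication datum: in any commutative
ring, with `P = x³ + ax + b`, `P' = 3x² + a`, `A = −6ax² + 9bx − 4a²`, `B = 18ax − 27b` one has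
`AP' + BP = −(4a³ + 27b²)` and `A²(P'² − 8xP) + (8xA² + 2ABP' + B²P)P = (AP' + BP)²`; so if
`di·(4a³ + 27b²) = 1` and `c4i·c4 = 1` then `di²A²·(P'² − 8xP) + di²(…)c4i·(c4·P) = 1`.
[folklore] -/
private theorem stub_dupDatum_bezout {R : Type*} [CommRing R] (a b x di c4 c4i : R)
    (hdi : di * (4 * a ^ 3 + 27 * b ^ 2) = 1) (h4 : c4i * c4 = 1) :
    di ^ 2 * (-(6 * a * x ^ 2) + 9 * b * x - 4 * a ^ 2) ^ 2 *
        ((3 * x ^ 2 + a) ^ 2 - 8 * x * (x ^ 3 + a * x + b)) +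
      di ^ 2 * (8 * x * (-(6 * a * x ^ 2) + 9 * b * x - 4 * a ^ 2) ^ 2 +
          2 * (-(6 * a * x ^ 2) + 9 * b * x - 4 * a ^ 2) * (18 * a * x - 27 * b) *
            (3 * x ^ 2 + a) +
          (18 * a * x - 27 * b) ^ 2 * (x ^ 3 + a * x + b)) * c4i *
        (c4 * (x ^ 3 + a * x + b)) = 1 := by
  have key : (-(6 * a * x ^ 2) + 9 * b * x - 4 * a ^ 2) * (3 * x ^ 2 + a) +
      (18 * a * x - 27 * b) * (x ^ 3 + a * x + b) = -(4 * a ^ 3 + 27 * b ^ 2) := by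
    ring
  linear_combination
    (di ^ 2 * (8 * x * (-(6 * a * x ^ 2) + 9 * b * x - 4 * a ^ 2) ^ 2 +
          2 * (-(6 * a * x ^ 2) + 9 * b * x - 4 * a ^ 2) * (18 * a * x - 27 * b) *
            (3 * x ^ 2 + a) +
          (18 * a * x - 27 * b) ^ 2 * (x ^ 3 + a * x + b)) * (x ^ 3 + a * x + b)) * h4 +
      (di ^ 2 * ((-(6 * a * x ^ 2) + 9 * b * x - 4 * a ^ 2) * (3 * x ^ 2 + a) +
          (18 * a * x - 27 * b) * (x ^ 3 + a * x + b) - (4 * a ^ 3 + 27 * b ^ 2))) * key +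
      (di * (4 * a ^ 3 + 27 * b ^ 2) + 1) * hdi

/-- Coprimality of the duplication datum of a nonsingular real curve: if `4α³ + 27β² ≠ 0` then
`f₂ = X⁴ − 2αX² − 8βX + α²` and `g₂ = 4(X³ + αX + β)` are coprime in `ℝ[X]`. [folklore] -/
private theorem stub_dupDatum_isCoprime (A B : ℝ) (hΔ : 4 * A ^ 3 + 27 * B ^ 2 ≠ 0) :
    IsCoprime (X ^ 4 - C (2 * A) * X ^ 2 - C (8 * B) * X + C (A ^ 2))
      (C 4 * (X ^ 3 + C A * X + C B)) := by
  have hf : (X ^ 4 - C (2 * A) * X ^ 2 - C (8 * B) * X + C (A ^ 2) : ℝ[X]) =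
      (3 * X ^ 2 + C A) ^ 2 - 8 * X * (X ^ 3 + C A * X + C B) := by
    simp only [map_mul, map_pow, map_ofNat]
    ring
  have hC : (4 * C A ^ 3 + 27 * C B ^ 2 : ℝ[X]) = C (4 * A ^ 3 + 27 * B ^ 2) := by
    simp only [map_add, map_mul, map_pow, map_ofNat]
  have hdi : C (4 * A ^ 3 + 27 * B ^ 2)⁻¹ * (4 * C A ^ 3 + 27 * C B ^ 2 : ℝ[X]) = 1 := by
    rw [hC, ← C_mul, inv_mul_cancel₀ hΔ, C_1]
  have h4 : C (4 : ℝ)⁻¹ * C (4 : ℝ) = 1 := by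
    rw [← C_mul, inv_mul_cancel₀ (by norm_num), C_1]
  rw [hf]
  exact ⟨_, _, stub_dupDatum_bezout (C A) (C B) X (C (4 * A ^ 3 + 27 * B ^ 2)⁻¹) (C 4) (C 4⁻¹)
    hdi h4⟩

/-- **2-descent square identity** for `y² = x³ + αx + β`: for every `e`,
`f₂ − e·g₂ = (x² − 2ex − 2e² − α)² − 4(2x + e)·(e³ + αe + β)`. [folklore] -/
private theorem stub_dupDatum_descent_identity {R : Type*} [CommRing R] (A B e x : R) :
    (x ^ 4 - 2 * A * x ^ 2 - 8 * B * x + A ^ 2) - e * (4 * (x ^ 3 + A * x + B)) =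
      (x ^ 2 - 2 * e * x - 2 * e ^ 2 - A) ^ 2 - 4 * (2 * x + e) * (e ^ 3 + A * e + B) := by
  ring

/-- On `{P > 0}` the duplication x-map dominates every real root `e` of `P`. [folklore] -/
private theorem stub_dupDatum_ge_root (A B e x : ℝ) (he : e ^ 3 + A * e + B = 0)
    (hx : 0 < x ^ 3 + A * x + B) :
    e ≤ (x ^ 4 - 2 * A * x ^ 2 - 8 * B * x + A ^ 2) / (4 * (x ^ 3 + A * x + B)) := by
  rw [le_div_iff₀ (by positivity)]
  have key := stub_dupDatum_descent_identity A B e x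
  rw [he, mul_zero, sub_zero] at key
  nlinarith [key, sq_nonneg (x ^ 2 - 2 * e * x - 2 * e ^ 2 - A)]

/-- **Port of the registered stub `stub_dupDatum`** (the duplication datum) of the `ℚ`-line to
real moduli. `[2]` on `y² = x³ + αx + β` is a datum `(f₂, g₂, 2)` of the crux's shape (Wronskian
non-zero, certificate identity), coprime when `4α³ + 27β² ≠ 0`, and its x-map dominates every real
root of `P` on `{P > 0}` (2-descent square identity). [folklore] -/
theorem stub_dupDatum : ∀ (α β : ℝ) (f₂ g₂ : Polynomial ℝ), f₂ = Polynomial.X ^ 4 - Polynomial.C (2 * α) * Polynomial.X ^ 2 - Polynomial.C (8 * β) * Polynomial.X + Polynomial.C (α ^ 2) → g₂ = Polynomial.C 4 * (Polynomial.X ^ 3 + Polynomial.C α * Polynomial.X + Polynomial.C β) → Polynomial.derivative f₂ * g₂ - f₂ * Polynomial.derivative g₂ ≠ 0 ∧ Polynomial.C ((2 : ℝ) ^ 2) * g₂ * (f₂ ^ 3 + Polynomial.C α * f₂ * g₂ ^ 2 + Polynomial.C β * g₂ ^ 3) = (Polynomial.X ^ 3 + Polynomial.C α * Polynomial.X + Polynomial.C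 β) * (Polynomial.derivative f₂ * g₂ - f₂ * Polynomial.derivative g₂) ^ 2 ∧ (4 * α ^ 3 + 27 * β ^ 2 ≠ 0 → IsCoprime f₂ g₂) ∧ ∀ e x : ℝ, e ^ 3 + α * e + β = 0 → 0 < x ^ 3 + α * x + β → e ≤ f₂.eval x / g₂.eval x := by
  intro A B f₂ g₂ hf₂ hg₂
  subst hf₂ hg₂
  refine ⟨stub_dupDatum_wronskian_ne_zero A B, stub_dupDatum_isDatum A B,
    fun hΔ => stub_dupDatum_isCoprime A B hΔ, ?_⟩
  intro e x he hx
  have h1 : (X ^ 4 - C (2 * A) * X ^ 2 - C (8 * B) * X + C (A ^ 2) : ℝ[X]).eval x =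
      x ^ 4 - 2 * A * x ^ 2 - 8 * B * x + A ^ 2 := by
    simp only [eval_sub, eval_add, eval_mul, eval_pow, eval_X, eval_C]
  have h2 : (C 4 * (X ^ 3 + C A * X + C B) : ℝ[X]).eval x = 4 * (x ^ 3 + A * x + B) := by
    simp only [eval_add, eval_mul, eval_pow, eval_X, eval_C]
  rw [h1, h2]
  exact stub_dupDatum_ge_root A B e x he hx

/-- The multiplier `2` of the duplication datum is a real algebraic number. [folklore] -/
theorem isAlgebraic_two : IsAlgebraic ℚ (2 : ℝ) := by
  exact_mod_cast isAlgebraic_nat (R := ℚ) (A := ℝ) 2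

/-- **The duplication datum has real-algebraic coefficients** when the moduli `α, β` are real
algebraic (so `(f₂, g₂, 2)` is a datum in the sense of the line `Sketch`, whose data are
`f g : ℝ[X]` with algebraic coefficients and an algebraic multiplier `c`, here `isAlgebraic_two`).
[folklore] -/
theorem dupDatum_coeff_isAlgebraic (α β : ℝ) (hα : IsAlgebraic ℚ α) (hβ : IsAlgebraic ℚ β)
    (f₂ g₂ : ℝ[X]) (hf₂ : f₂ = X ^ 4 - C (2 * α) * X ^ 2 - C (8 * β) * X + C (α ^ 2))
    (hg₂ : g₂ = C 4 * (X ^ 3 + C α * X + C β)) :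
    (∀ n, IsAlgebraic ℚ (f₂.coeff n)) ∧ (∀ n, IsAlgebraic ℚ (g₂.coeff n)) := by
  subst hf₂ hg₂
  have h4 : IsAlgebraic ℚ (4 : ℝ) := by exact_mod_cast isAlgebraic_nat (R := ℚ) (A := ℝ) 4
  have h8 : IsAlgebraic ℚ (8 : ℝ) := by exact_mod_cast isAlgebraic_nat (R := ℚ) (A := ℝ) 8
  have hite : ∀ (p : Prop) [Decidable p] {a : ℝ}, IsAlgebraic ℚ a →
      IsAlgebraic ℚ (if p then a else 0) := fun p _ a ha => by
    split_ifs
    · exact ha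
    · exact isAlgebraic_zero
  refine ⟨fun n => ?_, fun n => ?_⟩
  · simp only [coeff_add, coeff_sub, coeff_C_mul, coeff_X_pow, coeff_X, coeff_C]
    exact (((hite _ isAlgebraic_one).sub ((isAlgebraic_two.mul hα).mul (hite _ isAlgebraic_one))).sub
      ((h8.mul hβ).mul (hite _ isAlgebraic_one))).add (hite _ (hα.pow 2))
  · simp only [coeff_C_mul, coeff_add, coeff_X_pow, coeff_X, coeff_C]
    exact h4.mul (((hite _ isAlgebraic_one).add (hα.mul (hite _ isAlgebraic_one))).add (hite _ hβ))

end Summit.KontsevichZagierPeriods.IsogenyCertificates.AlgRealPeriodCell.TransferDupDatum
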